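import Summits.QuantumAdvantage.AdviceFreeQNC0.CubeTransfer
import HarnessLib

/-!
# Cell qa-qnc0 (rung F-Q1, route RingFrame, crux α, line `product`): `CubeCover` at `D = 2`, part 1/4 —
# a product formula for joint weight residues mod 3 of coordinatewise vertex maps on PAIRS of bits

Engine of `WeightClassCubes.lean` (the `D = 2` case of planner qa-qnc0-p1's `CubeCover`, T6(b) /
ask P7(b); see that file's docstring for the whole argument).  Here: for any family of `K` vertex
maps acting coordinatewise on a free vector `q ∈ ({0,1}²)^L`, the number of `q` all of whose
vertices have Hamming weight `≡ r (mod 3)` satisfies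
`3^K · N = Σ_{t ∈ (ℤ/3)^K} ω^{2r|t|} Π_j F_j(t)` with `F_j(t) = Σ_{β ∈ {0,1}²} ω^{Σ_κ t_κ [bit κ j β]}`
(`three_pow_mul_count_eq`; orthogonality `1 + ω^m + ω^{2m} = 3·[3 ∣ m]`), and the two norm facts
`|F_j| ≤ 4`, `|F_j| ≤ 3` unless the four exponents agree mod 3 (`norm_sum_omega3_pow_le_three`).
(The prover's `CubeCharacterSums.lean` is the analogous engine over general column alphabets for
all `D`; this file is the independent two-bit special case used by the second-moment route.)
WHAT THIS IS NOT: no cube geometry, nothing on α. [folklore]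
-/
noncomputable section

namespace Summit.QuantumAdvantage.AdviceFreeQNC0

open Finset
open Literature.Computability.MetaComplexity.Hegedus

-- the machinery of the `D = 2` cube count lives in its own namespace `CubeTwo`.
namespace CubeTwo

variable {L : ℕ}

/-! ### A product formula for simultaneous residue conditions on two free vectors -/

section ProductFormula

variable {K : ℕ}

/-- `3·[m ≡ r (mod 3)] = Σ_{s<3} ω^{s(m+2r)}`. [folklore] -/
theorem three_mul_ite_mod_eq_sum_omega3_pow (m r : ℕ) :
    (3 : ℂ) * (if m % 3 = r % 3 then 1 else 0) = ∑ s : Fin 3, omega3 ^ ((s : ℕ) * (m + 2 * r)) := by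
  rw [Fin.sum_univ_three]
  simp only [Fin.val_zero, Fin.val_one, Fin.val_two, zero_mul, pow_zero, one_mul]
  rw [one_add_omega3_pow_add_omega3_pow_two_mul (m + 2 * r)]
  by_cases h : m % 3 = r % 3
  · rw [if_pos h, if_pos (by omega)]; norm_num
  · rw [if_neg h, if_neg (by omega)]; norm_num

/-- The `j`-th bit of the `κ`-th vertex is `bit κ j (q j)` for a free vector of PAIRS `q`. -/
def vtx (bit : Fin K → Fin L → Bool × Bool → Bool) (κ : Fin K) (q : Fin L → Bool × Bool) :
    Fin L → Bool := fun j => bit κ j (q j)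

/-- the per-coordinate exponent `Σ_κ t_κ·[bit κ j β]`. -/
def expo (bit : Fin K → Fin L → Bool × Bool → Bool) (t : Fin K → Fin 3) (j : Fin L)
    (β : Bool × Bool) : ℕ := ∑ κ : Fin K, (t κ : ℕ) * (if bit κ j β = true then 1 else 0)

/-- the per-coordinate character factor `F_j(t) = Σ_β ω^{expo}`. -/
def factor (bit : Fin K → Fin L → Bool × Bool → Bool) (t : Fin K → Fin 3) (j : Fin L) : ℂ :=
  ∑ β : Bool × Bool, omega3 ^ expo bit t j β

/-- `wt v = Σ_j [v j]`. [folklore] -/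
theorem wt_eq_sum_ite (v : Fin L → Bool) : wt v = ∑ j, (if v j = true then 1 else 0) := by
  unfold wt; rw [Finset.card_filter]

/-- **Product formula.** `3^K · #{q : ∀ κ, wt(vtx κ q) ≡ r} = Σ_t ω^{2r·Σ_κ t_κ} · Π_j F_j(t)`.
[folklore] -/
theorem three_pow_mul_count_eq (bit : Fin K → Fin L → Bool × Bool → Bool) (r : ℕ) :
    (3 : ℂ) ^ K * ∑ q : Fin L → Bool × Bool,
        (if ∀ κ : Fin K, wt (vtx bit κ q) % 3 = r % 3 then (1 : ℂ) else 0) =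
      ∑ t : Fin K → Fin 3, omega3 ^ (2 * r * ∑ κ, (t κ : ℕ)) * ∏ j : Fin L, factor bit t j := by
  -- expand each indicator
  have hq : ∀ q : Fin L → Bool × Bool,
      (3 : ℂ) ^ K * (if ∀ κ : Fin K, wt (vtx bit κ q) % 3 = r % 3 then (1 : ℂ) else 0) =
        ∑ t : Fin K → Fin 3, omega3 ^ (2 * r * ∑ κ, (t κ : ℕ)) *
          ∏ j : Fin L, omega3 ^ expo bit t j (q j) := by
    intro q
    have e1 : (if ∀ κ : Fin K, wt (vtx bit κ q) % 3 = r % 3 then (1 : ℂ) else 0) =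
        ∏ κ : Fin K, (if wt (vtx bit κ q) % 3 = r % 3 then (1 : ℂ) else 0) := by
      rw [Fintype.prod_boole]
      by_cases h : ∀ κ : Fin K, wt (vtx bit κ q) % 3 = r % 3
      · rw [if_pos h, if_pos h]
      · rw [if_neg h, if_neg h]
    have e3 : (3 : ℂ) ^ K = ∏ _κ : Fin K, (3 : ℂ) := by
      rw [Finset.prod_const, Finset.card_univ, Fintype.card_fin]
    rw [e1, e3, ← Finset.prod_mul_distrib]
    simp_rw [three_mul_ite_mod_eq_sum_omega3_pow]
    rw [Fintype.prod_sum]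
    refine Finset.sum_congr rfl fun t _ => ?_
    rw [Finset.prod_pow_eq_pow_sum, Finset.prod_pow_eq_pow_sum, ← pow_add]
    congr 1
    have h1 : ∑ κ : Fin K, (t κ : ℕ) * (wt (vtx bit κ q) + 2 * r) =
        ∑ κ : Fin K, (t κ : ℕ) * wt (vtx bit κ q) + 2 * r * ∑ κ, (t κ : ℕ) := by
      rw [Finset.mul_sum, ← Finset.sum_add_distrib]
      refine Finset.sum_congr rfl fun κ _ => ?_; ring
    have h2 : ∑ κ : Fin K, (t κ : ℕ) * wt (vtx bit κ q) = ∑ j : Fin L, expo bit t j (q j) := by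
      simp_rw [wt_eq_sum_ite, Finset.mul_sum]
      rw [Finset.sum_comm]
      rfl
    rw [h1, h2, add_comm]
  rw [Finset.mul_sum]
  simp_rw [hq]
  rw [Finset.sum_comm]
  refine Finset.sum_congr rfl fun t _ => ?_
  rw [← Finset.mul_sum]
  congr 1
  unfold factor
  exact (Fintype.prod_sum fun (j : Fin L) (β : Bool × Bool) => omega3 ^ expo bit t j β).symm

end ProductFormula

/-! ### Norm bounds for sums of cube roots of unity -/

/-- `‖ω^a + ω^b‖ ≤ 1` when `a ≢ b (mod 3)`. [folklore] -/
theorem norm_omega3_pow_add_pow_le_one {a b : ℕ} (h : a % 3 ≠ b % 3) :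
    ‖omega3 ^ a + omega3 ^ b‖ ≤ 1 := by
  rw [omega3_pow_eq_pow_mod a, omega3_pow_eq_pow_mod b]
  have ha : a % 3 < 3 := Nat.mod_lt _ (by norm_num)
  have hb : b % 3 < 3 := Nat.mod_lt _ (by norm_num)
  have e12 : ‖omega3 + omega3 ^ 2‖ = 1 := by
    have h' : omega3 + omega3 ^ 2 = -1 := by linear_combination one_add_omega3_add_sq
    rw [h', norm_neg, norm_one]
  have e02 : ‖1 + omega3 ^ 2‖ = 1 := by
    have h' : (1 : ℂ) + omega3 ^ 2 = -omega3 := by linear_combination one_add_omega3_add_sq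
    rw [h', norm_neg, norm_omega3]
  interval_cases ha : a % 3 <;> interval_cases hb : b % 3 <;> simp_all only [ne_eq, not_true_eq_false]
  · rw [pow_zero, pow_one, norm_one_add_omega3]
  · rw [pow_zero, e02]
  · rw [pow_one, pow_zero, add_comm, norm_one_add_omega3]
  · rw [pow_one, e12]
  · rw [pow_zero, add_comm, e02]
  · rw [pow_one, add_comm, e12]

/-- A sum of four cube roots of unity has norm `≤ 4`. [folklore] -/
theorem norm_sum_omega3_pow_le_four (e : Bool × Bool → ℕ) :
    ‖∑ β : Bool × Bool, omega3 ^ e β‖ ≤ 4 := by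
  calc ‖∑ β : Bool × Bool, omega3 ^ e β‖ ≤ ∑ β : Bool × Bool, ‖omega3 ^ e β‖ := norm_sum_le _ _
    _ = 4 := by simp [norm_pow, norm_omega3]

/-- A sum of four cube roots of unity that are NOT all equal has norm `≤ 3`. [folklore] -/
theorem norm_sum_omega3_pow_le_three (e : Bool × Bool → ℕ)
    (h : ¬ (e (false, false) % 3 = e (true, false) % 3 ∧ e (false, false) % 3 = e (false, true) % 3 ∧
      e (false, false) % 3 = e (true, true) % 3)) :
    ‖∑ β : Bool × Bool, omega3 ^ e β‖ ≤ 3 := by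
  rw [Fintype.sum_prod_type]
  simp only [Fintype.sum_bool]
  have n1 : ∀ β, ‖omega3 ^ e β‖ = 1 := fun β => by rw [norm_pow, norm_omega3, one_pow]
  by_cases h1 : e (false, false) % 3 = e (true, false) % 3
  · by_cases h2 : e (false, false) % 3 = e (false, true) % 3
    · have h3 : e (false, false) % 3 ≠ e (true, true) % 3 := fun h3 => h ⟨h1, h2, h3⟩
      have key := norm_omega3_pow_add_pow_le_one h3
      calc ‖omega3 ^ e (true, true) + omega3 ^ e (true, false) +
            (omega3 ^ e (false, true) + omega3 ^ e (false, false))‖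
          = ‖(omega3 ^ e (false, false) + omega3 ^ e (true, true)) + omega3 ^ e (true, false) +
              omega3 ^ e (false, true)‖ := by ring_nf
        _ ≤ ‖omega3 ^ e (false, false) + omega3 ^ e (true, true)‖ + ‖omega3 ^ e (true, false)‖ +
              ‖omega3 ^ e (false, true)‖ := norm_add₃_le
        _ ≤ 1 + 1 + 1 := by rw [n1, n1]; linarith
        _ = 3 := by norm_num
    · have key := norm_omega3_pow_add_pow_le_one h2
      calc ‖omega3 ^ e (true, true) + omega3 ^ e (true, false) +
            (omega3 ^ e (false, true) + omega3 ^ e (false, false))‖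
          = ‖(omega3 ^ e (false, false) + omega3 ^ e (false, true)) + omega3 ^ e (true, true) +
              omega3 ^ e (true, false)‖ := by ring_nf
        _ ≤ ‖omega3 ^ e (false, false) + omega3 ^ e (false, true)‖ + ‖omega3 ^ e (true, true)‖ +
              ‖omega3 ^ e (true, false)‖ := norm_add₃_le
        _ ≤ 1 + 1 + 1 := by rw [n1, n1]; linarith
        _ = 3 := by norm_num
  · have key := norm_omega3_pow_add_pow_le_one h1
    calc ‖omega3 ^ e (true, true) + omega3 ^ e (true, false) +
          (omega3 ^ e (false, true) + omega3 ^ e (false, false))‖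
        = ‖(omega3 ^ e (false, false) + omega3 ^ e (true, false)) + omega3 ^ e (true, true) +
            omega3 ^ e (false, true)‖ := by ring_nf
      _ ≤ ‖omega3 ^ e (false, false) + omega3 ^ e (true, false)‖ + ‖omega3 ^ e (true, true)‖ +
            ‖omega3 ^ e (false, true)‖ := norm_add₃_le
      _ ≤ 1 + 1 + 1 := by rw [n1, n1]; linarith
      _ = 3 := by norm_num

end CubeTwo

end Summit.QuantumAdvantage.AdviceFreeQNC0

end
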